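import Summits.QuantumAdvantage.QuantumAdvantage.Theses.HankelLift

/-!
# `HankelLift.Assembly` (stmt-QuantumAdvantage-18443)

The assembly item of route `route-QuantumAdvantage-HankelLift`:
`LiouvilleSumMemBQP → HankelDiscrepancy → DiscToRules → BeyondRectangles → QuantumAdvantage`.
It is exactly the route's deciding theorem `HankelLift.closes` (error reduction to 1/200 for a
putative BPP decider of the lifted Liouville language, versus the ≤ 51 % rectangle-rule ceiling of
`DiscToRules (HankelDiscrepancy)` and the 1/10 margin of `BeyondRectangles`), curried.
-/

set_option linter.dupNamespace false -- D-0017: single-problem summit ⇒ `QuantumAdvantage.QuantumAdvantage` by design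

namespace Summit.QuantumAdvantage.QuantumAdvantage.Theorems

open Summit.QuantumAdvantage.QuantumAdvantage.Theses.HankelLift

/-- **`Assembly`** (stmt-QuantumAdvantage-18443): the four route items imply the summit statement
`QuantumAdvantage` — by the route's deciding theorem `HankelLift.closes`. [folklore] -/
theorem hankelLift_assembly_proof : Assembly :=
  fun h₁ h₂ h₃ h₄ => closes h₁ h₂ h₃ h₄

end Summit.QuantumAdvantage.QuantumAdvantage.Theorems
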